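import Summits.Ventures.PercRepro.S2ContractionRankExact
import Summits.Ventures.PercRepro.S2NuFourSimpleCounts

/-!
# PercRepro — S2: THE RANK CLASSES OF THE `j`-SUBSETS OF A SET, AND THE OUTSIDE COUNTS OF THE EXACT-RANK LEVER (p7, gen 18; sub-claim S2)

Bookkeeping for the exact-rank contraction lever `S2.ncard_top_le_sum_contract_rank_exact`, whose terms are
`#{T ⊆ W : |T| = j, ρ(T) = ρ} · #{X ⊆ E ∖ W : |X| = k, ρ_{M／W}(X) + ρ ≤ 5}`. The trace side: the six rank classes of the `j`-subsets of `W`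
sum to `≤ C(|W|, j)` (**`sum_ncard_rank_classes_le`**); a class is empty when its rank forces fewer than `j` points
(**`ncard_rank_class_eq_zero_of_forall_ncard_le`**), when `j < ρ` (**`ncard_rank_class_eq_zero_of_lt`**) or when `ρ` exceeds the rank of `W` (**`ncard_rank_class_eq_zero_of_lt_eRk`**); a class of rank `ρ < j`
consists of dependent sets (**`ncard_rank_class_le_dep`**); the independent `j`-sets are the class of rank `j`
(**`ncard_indep_le_rank_class`**); a class is inside the rank-`≤ ρ` sets (**`ncard_rank_class_le_eRk_le`**). The outside side: the
`k`-sets with `ρ_N(X) + ρ ≤ 5` number `≤ C(|E ∖ W|, k)` (**`ncard_outside_le_choose`**), none when `ρ = 5 < 5 + ρ_N(X)` for a nonempty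
`X` of a loopless `N` (**`ncard_outside_eq_zero_of_loopless`**), and they are the sets of rank `≤ s` when `s + ρ = 5`
(**`ncard_outside_le_eRk_le`**) — dependent when moreover `s < k` (**`ncard_outside_le_dep`**); and `ρ(X ∪ W) ≤ ρ(W) + ρ_{M／W}(X)`
(**`eRk_union_le_eRk_add_contract_eRk`**). For a SIMPLE outside matroid: no outside set of rank `≤ 1` with `≥ 2` points
(**`ncard_outside_eq_zero_of_simple`**), its dependent triples are `3`-circuits (**`ncard_dep_three_le_of_simple`**); and a loopless
matroid of dual rank `3` has at most four rank-`1` triples (**`ncard_three_eRk_le_one_le_four`**). Nothing about any cell is claimed.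
Axioms: standard.
-/

open scoped Matroid

namespace PercRepro

namespace S2

open Set

variable {α : Type}

/-- **The six rank classes of the `j`-subsets of `W` sum to at most `C(|W|, j)`.** -/
theorem sum_ncard_rank_classes_le (M : Matroid α) [M.Finite] {W : Set α} (hW : W ⊆ M.E) (j : ℕ) :
    ∑ ρ ∈ Finset.range 6, {T : Set α | T ⊆ W ∧ T.ncard = j ∧ M.eRk T = (ρ : ℕ∞)}.ncard ≤ W.ncard.choose j := by
  classical
  have hWfin : W.Finite := M.ground_finite.subset hW
  have hS : {T : Set α | T ⊆ W ∧ T.ncard = j}.Finite := hWfin.finite_subsets.subset (fun T hT => hT.1)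
  have hfin : ∀ ρ : ℕ, {T : Set α | T ⊆ W ∧ T.ncard = j ∧ M.eRk T = (ρ : ℕ∞)}.Finite :=
    fun ρ => hS.subset (fun T hT => ⟨hT.1, hT.2.1⟩)
  have hdisj : ((Finset.range 6 : Finset ℕ) : Set ℕ).PairwiseDisjoint (fun ρ => (hfin ρ).toFinset) := by
    intro ρ₁ _ ρ₂ _ hne
    rw [Function.onFun, Finset.disjoint_left]
    intro T h1 h2
    rw [Set.Finite.mem_toFinset] at h1 h2
    have h := h1.2.2.symm.trans h2.2.2
    exact hne (by exact_mod_cast h)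
  calc ∑ ρ ∈ Finset.range 6, {T : Set α | T ⊆ W ∧ T.ncard = j ∧ M.eRk T = (ρ : ℕ∞)}.ncard
      = ∑ ρ ∈ Finset.range 6, ((hfin ρ).toFinset).card := by
        refine Finset.sum_congr rfl (fun ρ _ => ?_)
        exact Set.ncard_eq_toFinset_card _ (hfin ρ)
    _ = ((Finset.range 6).biUnion (fun ρ => (hfin ρ).toFinset)).card := (Finset.card_biUnion hdisj).symm
    _ ≤ hS.toFinset.card := by
        refine Finset.card_le_card ?_
        intro T hT
        rw [Finset.mem_biUnion] at hT
        obtain ⟨ρ, -, hTρ⟩ := hT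
        rw [Set.Finite.mem_toFinset] at hTρ ⊢
        exact ⟨hTρ.1, hTρ.2.1⟩
    _ = W.ncard.choose j := by
        rw [← Set.ncard_eq_toFinset_card _ hS]
        exact ncard_subsets_ncard_eq W hWfin j

/-- A rank class is empty when sets of that rank have fewer than `j` points. -/
theorem ncard_rank_class_eq_zero_of_forall_ncard_le (M : Matroid α) [M.Finite] {W : Set α} (hW : W ⊆ M.E) {j ρ c : ℕ}
    (h : ∀ T ⊆ W, M.eRk T ≤ (ρ : ℕ∞) → T.ncard ≤ c) (hj : c < j) :
    {T : Set α | T ⊆ W ∧ T.ncard = j ∧ M.eRk T = (ρ : ℕ∞)}.ncard = 0 := by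
  rw [Set.ncard_eq_zero ((M.ground_finite.subset hW).finite_subsets.subset (fun T hT => hT.1)),
    Set.eq_empty_iff_forall_notMem]
  rintro T ⟨hTW, hTj, hTr⟩
  have := h T hTW hTr.le
  omega

/-- A rank class is empty when `j < ρ` (the rank of a `j`-set is at most `j`). -/
theorem ncard_rank_class_eq_zero_of_lt (M : Matroid α) [M.Finite] {W : Set α} (hW : W ⊆ M.E) {j ρ : ℕ} (hj : j < ρ) :
    {T : Set α | T ⊆ W ∧ T.ncard = j ∧ M.eRk T = (ρ : ℕ∞)}.ncard = 0 := by
  rw [Set.ncard_eq_zero ((M.ground_finite.subset hW).finite_subsets.subset (fun T hT => hT.1)),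
    Set.eq_empty_iff_forall_notMem]
  rintro T ⟨hTW, hTj, hTr⟩
  have h := M.eRk_le_encard T
  rw [hTr, ← (M.ground_finite.subset (hTW.trans hW)).cast_ncard_eq, hTj] at h
  have : ρ ≤ j := by exact_mod_cast h
  omega

/-- A rank class is empty when `ρ` exceeds the rank of `W`. -/
theorem ncard_rank_class_eq_zero_of_lt_eRk (M : Matroid α) [M.Finite] {W : Set α} (hW : W ⊆ M.E) {r : ℕ}
    (hr : M.eRk W = (r : ℕ∞)) {j ρ : ℕ} (hρ : r < ρ) :
    {T : Set α | T ⊆ W ∧ T.ncard = j ∧ M.eRk T = (ρ : ℕ∞)}.ncard = 0 := by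
  rw [Set.ncard_eq_zero ((M.ground_finite.subset hW).finite_subsets.subset (fun T hT => hT.1)),
    Set.eq_empty_iff_forall_notMem]
  rintro T ⟨hTW, -, hTr⟩
  have h := M.eRk_mono hTW
  rw [hTr, hr] at h
  have : ρ ≤ r := by exact_mod_cast h
  omega

/-- The rank class `ρ < j` consists of dependent sets. -/
theorem ncard_rank_class_le_dep (M : Matroid α) [M.Finite] {W : Set α} (hW : W ⊆ M.E) {j ρ : ℕ} (hρ : ρ < j) :
    {T : Set α | T ⊆ W ∧ T.ncard = j ∧ M.eRk T = (ρ : ℕ∞)}.ncard ≤ {T : Set α | T ⊆ W ∧ T.ncard = j ∧ M.Dep T}.ncard := by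
  refine Set.ncard_le_ncard ?_ ((M.ground_finite.subset hW).finite_subsets.subset (fun T hT => hT.1))
  rintro T ⟨hTW, hTj, hTr⟩
  refine ⟨hTW, hTj, ?_⟩
  have hTfin : T.Finite := M.ground_finite.subset (hTW.trans hW)
  rw [← Matroid.eRk_lt_encard_iff_dep_of_finite hTfin (hTW.trans hW), hTr, ← hTfin.cast_ncard_eq, hTj]
  exact_mod_cast hρ

/-- The independent `j`-subsets of `W` lie in the rank class `ρ = j`. -/
theorem ncard_indep_le_rank_class (M : Matroid α) [M.Finite] {W : Set α} (hW : W ⊆ M.E) (j : ℕ) :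
    {T : Set α | T ⊆ W ∧ T.ncard = j ∧ M.Indep T}.ncard ≤ {T : Set α | T ⊆ W ∧ T.ncard = j ∧ M.eRk T = (j : ℕ∞)}.ncard := by
  refine Set.ncard_le_ncard ?_ ((M.ground_finite.subset hW).finite_subsets.subset (fun T hT => hT.1))
  rintro T ⟨hTW, hTj, hTi⟩
  refine ⟨hTW, hTj, ?_⟩
  rw [hTi.eRk_eq_encard, ← (M.ground_finite.subset (hTW.trans hW)).cast_ncard_eq, hTj]

/-- A rank class lies inside the sets of rank `≤ ρ`. -/
theorem ncard_rank_class_le_eRk_le (M : Matroid α) [M.Finite] {W : Set α} (hW : W ⊆ M.E) (j ρ : ℕ) :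
    {T : Set α | T ⊆ W ∧ T.ncard = j ∧ M.eRk T = (ρ : ℕ∞)}.ncard ≤ {T : Set α | T ⊆ W ∧ T.ncard = j ∧ M.eRk T ≤ (ρ : ℕ∞)}.ncard := by
  refine Set.ncard_le_ncard ?_ ((M.ground_finite.subset hW).finite_subsets.subset (fun T hT => hT.1))
  rintro T ⟨hTW, hTj, hTr⟩
  exact ⟨hTW, hTj, hTr.le⟩

/-- **The rank of `X ∪ W` is at most `ρ(W) + ρ_{M／W}(X)`** for `X` outside `W` (a basis of `X` in the contraction together with a
basis of `W` spans `X ∪ W`). -/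
theorem eRk_union_le_eRk_add_contract_eRk (M : Matroid α) [M.Finite] {W X : Set α} (hW : W ⊆ M.E) (hX : X ⊆ M.E \ W) :
    M.eRk (X ∪ W) ≤ M.eRk W + (M ／ W).eRk X := by
  obtain ⟨I, hI⟩ := M.exists_isBasis W hW
  have hXN : X ⊆ (M ／ W).E := by rw [Matroid.contract_ground]; exact hX
  obtain ⟨J, hJ⟩ := (M ／ W).exists_isBasis X hXN
  have hJI : M.Indep (J ∪ I) := (hI.contract_indep_iff.1 hJ.indep).1
  have hXcl : X ⊆ M.closure (J ∪ I) := by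
    have h1 : X ⊆ (M ／ W).closure J := hJ.subset_closure
    rw [Matroid.contract_closure_eq, Matroid.closure_union_congr_right hI.closure_eq_closure.symm] at h1
    exact h1.trans Set.sdiff_subset
  have hWcl : W ⊆ M.closure (J ∪ I) :=
    hI.subset_closure.trans (M.closure_subset_closure Set.subset_union_right)
  calc M.eRk (X ∪ W) ≤ M.eRk (M.closure (J ∪ I)) := M.eRk_mono (Set.union_subset hXcl hWcl)
    _ = M.eRk (J ∪ I) := M.eRk_closure_eq _
    _ ≤ (J ∪ I).encard := M.eRk_le_encard _
    _ ≤ J.encard + I.encard := Set.encard_union_le _ _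
    _ = (M ／ W).eRk X + M.eRk W := by rw [hJ.encard_eq_eRk, hI.encard_eq_eRk]
    _ = M.eRk W + (M ／ W).eRk X := add_comm _ _

/-- A set of rank `0` in a loopless matroid is empty. -/
theorem ncard_le_zero_of_eRk_le_zero (M : Matroid α) (hL : ∀ e ∈ M.E, ¬ M.IsLoop e) {T : Set α} (hT : T ⊆ M.E)
    (hr : M.eRk T ≤ 0) : T.ncard ≤ 0 := by
  rcases T.eq_empty_or_nonempty with h | h
  · rw [h, Set.ncard_empty]
  · have h1 := one_le_eRk_of_nonempty M hL hT h
    exact absurd (h1.trans hr) (by decide)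

/-- A set of rank `≤ 1` has at most one point when distinct points have rank `2`. -/
theorem ncard_le_one_of_eRk_le_one (M : Matroid α) [M.Finite] (hs : ∀ e ∈ M.E, ∀ f ∈ M.E, e ≠ f → M.eRk {e, f} = 2)
    {T : Set α} (hT : T ⊆ M.E) (hr : M.eRk T ≤ 1) : T.ncard ≤ 1 := by
  rw [Set.ncard_le_one_iff (M.ground_finite.subset hT)]
  intro a b ha hb
  by_contra hab
  have h := M.eRk_mono (Set.pair_subset ha hb)
  rw [hs a (hT ha) b (hT hb) hab] at h
  exact absurd (h.trans hr) (by decide)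

/-- **The outside `k`-sets of the lever number at most `C(|S|, k)`.** -/
theorem ncard_outside_le_choose (N : Matroid α) {S : Set α} (hS : S.Finite) (k : ℕ) (ρ : ℕ∞) :
    {X : Set α | X ⊆ S ∧ X.ncard = k ∧ N.eRk X + ρ ≤ 5}.ncard ≤ S.ncard.choose k := by
  rw [← ncard_subsets_ncard_eq S hS k]
  exact Set.ncard_le_ncard (fun X hX => ⟨hX.1, hX.2.1⟩) (hS.finite_subsets.subset (fun X hX => hX.1))

/-- **No nonempty outside set at `ρ = 5`** when `N` is loopless on `S`. -/
theorem ncard_outside_eq_zero_of_loopless (N : Matroid α) {S : Set α} (hS : S.Finite) (hSE : S ⊆ N.E)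
    (hL : ∀ e ∈ N.E, ¬ N.IsLoop e) {k : ℕ} (hk : 1 ≤ k) :
    {X : Set α | X ⊆ S ∧ X.ncard = k ∧ N.eRk X + 5 ≤ 5}.ncard = 0 := by
  rw [Set.ncard_eq_zero (hS.finite_subsets.subset (fun X hX => hX.1)), Set.eq_empty_iff_forall_notMem]
  rintro X ⟨hXS, hXk, hXr⟩
  have hne : X.Nonempty := by
    rw [← Set.ncard_pos (hS.subset hXS)]
    omega
  have h1 := one_le_eRk_of_nonempty N hL (hXS.trans hSE) hne
  have h2 : N.eRk X + 5 ≤ 0 + 5 := by simpa using hXr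
  have h3 : N.eRk X ≤ 0 := (ENat.add_le_add_iff_right (by decide)).1 h2
  exact absurd (h1.trans h3) (by decide)

/-- **The outside sets at `ρ` are the sets of rank `≤ s`** when `s + ρ = 5`. -/
theorem ncard_outside_le_eRk_le (N : Matroid α) {S : Set α} (hS : S.Finite) (k : ℕ) {s ρ : ℕ} (hsρ : s + ρ = 5) :
    {X : Set α | X ⊆ S ∧ X.ncard = k ∧ N.eRk X + (ρ : ℕ∞) ≤ 5}.ncard ≤
      {X : Set α | X ⊆ S ∧ X.ncard = k ∧ N.eRk X ≤ (s : ℕ∞)}.ncard := by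
  refine Set.ncard_le_ncard ?_ (hS.finite_subsets.subset (fun X hX => hX.1))
  rintro X ⟨hXS, hXk, hXr⟩
  refine ⟨hXS, hXk, ?_⟩
  have h : N.eRk X + (ρ : ℕ∞) ≤ (s : ℕ∞) + (ρ : ℕ∞) := by
    rw [← Nat.cast_add, hsρ]
    exact hXr
  exact (ENat.add_le_add_iff_right (WithTop.natCast_ne_top ρ)).1 h

/-- **The outside sets at `ρ` are dependent** when `s + ρ = 5` and `s < k`. -/
theorem ncard_outside_le_dep (N : Matroid α) [N.Finite] {S : Set α} (hS : S.Finite) (hSE : S ⊆ N.E) (k : ℕ) {s ρ : ℕ}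
    (hsρ : s + ρ = 5) (hsk : s < k) :
    {X : Set α | X ⊆ S ∧ X.ncard = k ∧ N.eRk X + (ρ : ℕ∞) ≤ 5}.ncard ≤
      {X : Set α | X ⊆ S ∧ X.ncard = k ∧ N.Dep X}.ncard := by
  refine (ncard_outside_le_eRk_le N hS k hsρ).trans ?_
  refine Set.ncard_le_ncard ?_ (hS.finite_subsets.subset (fun X hX => hX.1))
  rintro X ⟨hXS, hXk, hXr⟩
  refine ⟨hXS, hXk, ?_⟩
  have hXfin : X.Finite := hS.subset hXS
  rw [← Matroid.eRk_lt_encard_iff_dep_of_finite hXfin (hXS.trans hSE), ← hXfin.cast_ncard_eq, hXk]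
  exact hXr.trans_lt (by exact_mod_cast hsk)

/-- **No outside set of rank `≤ 1` with `≥ 2` points in a simple matroid** (its pairs are independent). -/
theorem ncard_outside_eq_zero_of_simple (N : Matroid α) [N.Finite] {S : Set α} (hS : S.Finite) (hSE : S ⊆ N.E)
    (hs2 : ∀ X ⊆ N.E, X.ncard = 2 → N.Indep X) {k s ρ : ℕ} (hsρ : s + ρ = 5) (hs1 : s ≤ 1) (hk : 2 ≤ k) :
    {X : Set α | X ⊆ S ∧ X.ncard = k ∧ N.eRk X + (ρ : ℕ∞) ≤ 5}.ncard = 0 := by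
  rw [Set.ncard_eq_zero (hS.finite_subsets.subset (fun X hX => hX.1)), Set.eq_empty_iff_forall_notMem]
  rintro X ⟨hXS, hXk, hXr⟩
  have hXfin : X.Finite := hS.subset hXS
  have hr1 : N.eRk X ≤ 1 := by
    have h : N.eRk X + (ρ : ℕ∞) ≤ (s : ℕ∞) + (ρ : ℕ∞) := by
      rw [← Nat.cast_add, hsρ]
      exact hXr
    have h2 := (ENat.add_le_add_iff_right (WithTop.natCast_ne_top ρ)).1 h
    exact h2.trans (by exact_mod_cast hs1)
  -- two points of `X` form an independent pair of rank `2`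
  obtain ⟨Y, hYX, hY2⟩ := Set.exists_subset_encard_eq (s := X) (k := 2) (by
    rw [← hXfin.cast_ncard_eq, hXk]; exact_mod_cast hk)
  have hYfin : Y.Finite := hXfin.subset hYX
  have hY2' : Y.ncard = 2 := by
    have h := hY2
    rw [← hYfin.cast_ncard_eq] at h
    exact_mod_cast h
  have hYi := hs2 Y ((hYX.trans hXS).trans hSE) hY2'
  have h2 : N.eRk Y = 2 := by rw [hYi.eRk_eq_encard, hY2]
  have h3 : N.eRk Y ≤ 1 := (N.eRk_mono hYX).trans hr1
  rw [h2] at h3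
  exact absurd h3 (by decide)

/-- **The dependent triples of a simple matroid are its `3`-circuits**: at most `C(ν + 2, 3)`. -/
theorem ncard_dep_three_le_of_simple (N : Matroid α) [N.Finite] {ν : ℕ} (hν : N✶.eRank = (ν : ℕ∞))
    (hL : ∀ e ∈ N.E, ¬ N.IsLoop e) (hs : ∀ X ⊆ N.E, X.ncard = 2 → N.Indep X) :
    {X : Set α | X ⊆ N.E ∧ X.ncard = 3 ∧ N.Dep X}.ncard ≤ (ν + 2).choose 3 := by
  have hsub : {X : Set α | X ⊆ N.E ∧ X.ncard = 3 ∧ N.Dep X} ⊆ {C : Set α | N.IsCircuit C ∧ C.ncard = 3} := by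
    rintro X ⟨hXE, hX3, hXdep⟩
    have hXfin : X.Finite := N.ground_finite.subset hXE
    obtain ⟨C, hCX, hC⟩ := hXdep.exists_isCircuit_subset
    have hCfin : C.Finite := hXfin.subset hCX
    have hC3 : C.ncard ≤ 3 := by
      have := Set.ncard_le_ncard hCX hXfin
      omega
    have hC1 : C.ncard ≠ 1 := by
      intro h1
      obtain ⟨e, rfl⟩ := Set.ncard_eq_one.1 h1
      exact hL e (hC.subset_ground (Set.mem_singleton e)) (Matroid.singleton_isCircuit.1 hC)
    have hC0 : C.ncard ≠ 0 := by
      intro h0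
      rw [Set.ncard_eq_zero hCfin] at h0
      exact hC.nonempty.ne_empty h0
    have hC2 : C.ncard ≠ 2 := fun h2 => hC.dep.not_indep (hs C hC.subset_ground h2)
    have hCeq : C = X := Set.eq_of_subset_of_ncard_le hCX (by omega) hXfin
    exact ⟨hCeq ▸ hC, hX3⟩
  have h := Matroid.ncard_circuits_le_choose N hν 2
  exact (Set.ncard_le_ncard hsub (N.ground_finite.finite_subsets.subset (fun C hC => hC.1.subset_ground))).trans h

/-- **At most four rank-`1` triples** in a loopless matroid of dual rank `3`: two of them meet (disjoint ones would span `6` points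
of rank `≤ 2`), so all lie in one rank-`1` set of `≤ 4` points. -/
theorem ncard_three_eRk_le_one_le_four (N : Matroid α) [N.Finite] (hν : N✶.eRank = ((3 : ℕ) : ℕ∞))
    (hL : ∀ e ∈ N.E, ¬ N.IsLoop e) :
    {X : Set α | X ⊆ N.E ∧ X.ncard = 3 ∧ N.eRk X ≤ 1}.ncard ≤ 4 := by
  classical
  set S := {X : Set α | X ⊆ N.E ∧ X.ncard = 3 ∧ N.eRk X ≤ 1} with hSdef
  have hSfin : S.Finite := N.ground_finite.finite_subsets.subset (fun X hX => hX.1)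
  rcases S.eq_empty_or_nonempty with hS | ⟨X₀, hX₀⟩
  · rw [hS, Set.ncard_empty]; norm_num
  obtain ⟨hX₀E, hX₀3, hX₀r⟩ := hX₀
  have hX₀fin : X₀.Finite := N.ground_finite.subset hX₀E
  -- every rank-`1` triple lies in the closure of `X₀`
  set Z := N.closure X₀ ∩ N.E with hZdef
  have hZE : Z ⊆ N.E := Set.inter_subset_right
  have hZfin : Z.Finite := N.ground_finite.subset hZE
  have hZr : N.eRk Z ≤ 1 := by
    calc N.eRk Z ≤ N.eRk (N.closure X₀) := N.eRk_mono Set.inter_subset_left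
      _ = N.eRk X₀ := N.eRk_closure_eq X₀
      _ ≤ 1 := hX₀r
  have hZcard : Z.ncard ≤ 4 := by
    have h := encard_le_eRk_add_of_dual_eRank N hν hZE
    have h2 : Z.encard ≤ 1 + ((3 : ℕ) : ℕ∞) := h.trans (add_le_add_left hZr _)
    rw [← hZfin.cast_ncard_eq] at h2
    norm_num at h2
    exact_mod_cast h2
  have hsub : S ⊆ {Y : Set α | Y ⊆ Z ∧ Y.ncard = 3} := by
    rintro Y ⟨hYE, hY3, hYr⟩
    refine ⟨?_, hY3⟩
    have hYfin : Y.Finite := N.ground_finite.subset hYE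
    -- `X₀ ∪ Y` has rank `≤ 1`: they meet, else `6` points of rank `≤ 2` against the nullity `3`
    have hU : N.eRk (X₀ ∪ Y) ≤ 1 := by
      by_cases hmeet : (X₀ ∩ Y).Nonempty
      · have h1 := N.eRk_inter_add_eRk_union_le X₀ Y
        have h2 := one_le_eRk_of_nonempty N hL (Set.inter_subset_left.trans hX₀E) hmeet
        have h3 : 1 + N.eRk (X₀ ∪ Y) ≤ 1 + 1 := by
          calc 1 + N.eRk (X₀ ∪ Y) ≤ N.eRk (X₀ ∩ Y) + N.eRk (X₀ ∪ Y) := add_le_add_left h2 _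
            _ ≤ N.eRk X₀ + N.eRk Y := h1
            _ ≤ 1 + 1 := add_le_add hX₀r hYr
        exact (ENat.add_le_add_iff_left (by decide)).1 h3
      · exfalso
        rw [Set.not_nonempty_iff_eq_empty] at hmeet
        have hdisj : Disjoint X₀ Y := Set.disjoint_iff_inter_eq_empty.2 hmeet
        have hcard : (X₀ ∪ Y).ncard = 6 := by
          rw [Set.ncard_union_eq hdisj hX₀fin hYfin, hX₀3, hY3]
        have h := encard_le_eRk_add_of_dual_eRank N hν (Set.union_subset hX₀E hYE)
        have hr2 : N.eRk (X₀ ∪ Y) ≤ 2 := by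
          calc N.eRk (X₀ ∪ Y) ≤ N.eRk X₀ + N.eRk Y := N.eRk_union_le_eRk_add_eRk _ _
            _ ≤ 1 + 1 := add_le_add hX₀r hYr
            _ = 2 := by norm_num
        have h2 : (X₀ ∪ Y).encard ≤ 2 + ((3 : ℕ) : ℕ∞) := h.trans (add_le_add_left hr2 _)
        rw [← (hX₀fin.union hYfin).cast_ncard_eq, hcard] at h2
        norm_num at h2
    intro y hy
    refine ⟨?_, hYE hy⟩
    by_contra hyc
    have h1 : N.eRk (insert y X₀) = N.eRk X₀ + 1 := Matroid.eRk_insert_eq_add_one ⟨hYE hy, hyc⟩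
    have h2 : N.eRk (insert y X₀) ≤ N.eRk (X₀ ∪ Y) :=
      N.eRk_mono (Set.insert_subset (Set.mem_union_right _ hy) Set.subset_union_left)
    have h3 : 1 ≤ N.eRk X₀ := one_le_eRk_of_nonempty N hL hX₀E (by
      rw [← Set.ncard_pos hX₀fin, hX₀3]; norm_num)
    have h4 : (2 : ℕ∞) ≤ N.eRk (X₀ ∪ Y) := by
      calc (2 : ℕ∞) = 1 + 1 := by norm_num
        _ ≤ N.eRk X₀ + 1 := add_le_add_left h3 _
        _ = N.eRk (insert y X₀) := h1.symm
        _ ≤ N.eRk (X₀ ∪ Y) := h2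
    exact absurd (h4.trans hU) (by decide)
  calc S.ncard ≤ {Y : Set α | Y ⊆ Z ∧ Y.ncard = 3}.ncard :=
        Set.ncard_le_ncard hsub (hZfin.finite_subsets.subset (fun Y hY => hY.1))
    _ = Z.ncard.choose 3 := ncard_subsets_ncard_eq Z hZfin 3
    _ ≤ (4 : ℕ).choose 3 := Nat.choose_le_choose 3 hZcard
    _ = 4 := by decide

end S2

end PercRepro
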